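import Literature.AnabelianGeometry.AbsoluteAnabelian.AbsTopIII.DivisorSections
import HarnessLib

/-!
# [AbsTopIII] Prop. 1.6 (ii) as the schema `DivisorCurveModel.Prop_1_6_ii` (FACT-LIST F-0351):
# the universal closure is REFUTABLE modulo the Kummer-faithfulness of one field (e.g. F-0369)

S. Mochizuki, *Topics in absolute anabelian geometry III: global reconstruction algorithms*
[MochizukiAbsTopIII2015]; kurims manuscript pages (`paper:url-5493eb38cbb7`): Prop. 1.6 (ii) p. 35
(setting p. 34); Def. 1.5 p. 32 (Kummer-faithful); Rmk. 1.5.4 (i) p. 33 ("sub-`p`-adic ⟹ Kummer-faithful").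

PROOF-ONLY negative-knowledge file (no definition, no instance) next to the trunk file
`AbsTopIII/DivisorSections.lean` (seat abc-iut-L4-t1), abc-iut cell seat abc-iut-f-080 (block F, FACT-LIST
row **F-0351** `AbsTopIII.DivisorCurveModel.Prop_1_6_ii`, class `preparatory`, kernel_closedness
`parametrised`).

`DivisorCurveModel.Prop_1_6_ii M` is a PREDICATE on an INTERFACE `M : DivisorCurveModel` (typing policy θ:
"the comparison with geometry is a NAMED FACT relative to a model"; the intended `M` is the étale-`π₁`
assignment, not constructed in the tree).  Print asserts Prop. 1.6 (ii) for THAT model only.  The tree has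
NO consumer binding the row as a hypothesis (it is cited in docstrings of `Thm19CuspidalDegree.lean` only)
and no instance of the interface, so no instance form is available to prove.

This file supplies the kernel object saying that the UNIVERSAL closure `∀ M, M.Prop_1_6_ii` is false AS
SOON AS one field `k` (of characteristic zero) is Kummer-faithful (`exists_not_prop_1_6_ii_of_isKummerFaithful`):
at the SPLIT junk model over `k` (`Π = G_k`, augmentation the identity, so `Δ = 1` and `Δ^ab = 1`; two
rational points with the tautological section; `ord_x ≡ 0` for every point, so only the zero divisor is
principal) the degree-zero divisor `[x₁] − [x₂]` has a principal (indeed trivial) divisor cocycle but is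
not principal, contradicting the "if and only if".  The hypothesis `IsKummerFaithful k` of the row cannot
be discharged for any concrete field from Mathlib today (its abelian-variety clause is Mattuck /
Mordell–Weil-type finiteness), so the unconditional `¬ ∀` is recorded MODULO the FACT-LIST row F-0369
`Rmk_1_5_4_i` ("sub-`p`-adic ⟹ Kummer-faithful"), `ℚ_p` being sub-`p`-adic by definition
(`not_forall_prop_1_6_ii_of_rmk_1_5_4_i`): the closed schema of F-0351 and F-0369 are JOINTLY
INCONSISTENT, so F-0351 is admissible ONLY relative to the intended model (FACT-LIST class
«universal-closure REFUTED (modulo F-0369); instance form: no instance in tree»), never as a `∀ M`-binder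
of a conditional certificate.  Refereed pre-IUT material; refuted-as-schema is not a defect of print, whose
statement is the instance; nothing here bears on [IUTchIII] Cor. 3.12 or takes a side.
-/

noncomputable section

open CategoryTheory
open scoped Classical

namespace Literature.AnabelianGeometry.AbsoluteAnabelian.AbsTopIII.DivisorCurveModel

/-- **F-0351 as a schema is false at an explicit junk model, given ONE Kummer-faithful field**
(Prop. 1.6 (ii) p. 35): for a Kummer-faithful field `k` of characteristic zero, the SPLIT model over `k`
(one proper scheme-like curve; `1 → Δ → Π → G_k → 1` with `Π = G_k` and the identity augmentation, so
`Δ^ab` is trivial and EVERY cocycle is principal; two `k`-rational points `x₁, x₂` with the tautological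
section; orders `ord_x ≡ 0`, so a divisor is principal iff it is zero) violates the typed "`t_D` coincides
with the identity section iff `D` is principal" at the degree-zero divisor `D = [x₁] − [x₂]`.  (Print's
Prop. 1.6 (ii) concerns the étale-`π₁` model, where `Δ^ab = T(J)` is far from trivial.)
[cite: MochizukiAbsTopIII2015, Prop 1.6 (ii) p.35] -/
theorem exists_not_prop_1_6_ii_of_isKummerFaithful (k : Type) [Field k] [CharZero k]
    (hk : IsKummerFaithful k) :
    ∃ M : DivisorCurveModel.{0},
      ¬ Literature.AnabelianGeometry.AbsoluteAnabelian.AbsTopIII.DivisorCurveModel.Prop_1_6_ii M := by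
  -- the split extension `Π = G_k`, identity augmentation
  let Gk : ProfiniteGrp.{0} := absoluteGaloisGrp k
  let E : FundamentalExtension.{0} :=
    { arith := Gk, gal := Gk, aug := ContinuousMonoidHom.id _, aug_surjective := fun x => ⟨x, rfl⟩ }
  -- the tautological section
  let s : E.Section := { toHom := ContinuousMonoidHom.id _, aug_toHom := fun _ => rfl }
  -- no cusps
  let C : E.CuspidalData :=
    { Cusp := PEmpty.{1}, Dcusp := fun x => x.elim, Icusp := fun x => x.elim,
      Icusp_eq := fun x => x.elim, isClosed_Dcusp := fun x => x.elim, eq_of_conj := fun x => x.elim }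
  -- the junk model: one curve over `k`, two rational points, `ord ≡ 0`
  let M : DivisorCurveModel.{0} :=
    { Curve := PUnit.{2}
      base := fun _ => k
      ext := fun _ => E
      galIso := fun _ => Iso.refl _
      cusps := fun _ => C
      IsProper := fun _ => True
      IsScheme := fun _ => True
      genus := fun _ => 0
      FunctionField := fun _ => k
      Point := fun _ => Bool
      decomp := fun _ _ => s.decompositionGroup
      IsNFCurve := fun _ => True
      IsNFPoint := fun _ _ => True
      IsNFRational := fun _ _ => True
      IsNFConstant := fun _ _ => True
      NFFunctionField := fun _ => k
      IsStrictlyBelyiType := fun _ => True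
      IsCofiniteOpen := fun _ _ => True
      res := fun _ => 𝟙 E
      IsRationalPt := fun _ _ => True
      ptSection := fun _ _ => s
      ptSection_range := fun _ _ => rfl
      ord := fun _ => 1 }
  -- the degree-zero divisor `[x₁] − [x₂]`
  let d : Bool → ℤ := fun b => cond b 1 (-1)
  let D : Bool →₀ ℤ := Finsupp.equivFunOnFinite.symm d
  have hD : ∀ b, D b = d b := fun b => by simp [D]
  have hdeg : (∑ x ∈ D.support, D x) = 0 := by
    change D.sum (fun _ n => n) = 0
    rw [Finsupp.sum_fintype _ _ (fun _ => rfl), Fintype.sum_bool, hD, hD]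
    rfl
  -- `Δ^ab` of the split extension is trivial, so every cocycle is principal
  -- (instances on `Π_{J¹}` of the `let`-bound extension are reached by unification only: no lemma needing
  -- fresh instance synthesis is used here)
  have hgeom : ∀ y : geomAbelianized E, y = 1 := by
    rintro ⟨_, x, hx, rfl⟩
    have hx1 : x = 1 := hx
    subst hx1
    rfl
  refine ⟨M, fun hP => ?_⟩
  have h := hP PUnit.unit trivial trivial hk D (fun _ _ => trivial) hdeg s
  -- the divisor cocycle of `D` is principal (indeed every cocycle is), so `D` would be principal
  obtain ⟨f, hf⟩ := h.1 ⟨1, fun σ => (hgeom _).trans (hgeom _).symm⟩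
  -- `ord_{x₁} ≡ 0` but `D(x₁) = 1`
  have h0 : M.ord (U := PUnit.unit) true = 1 := rfl
  have h1 := hf true
  rw [h0, MonoidHom.one_apply, toAdd_one, hD] at h1
  exact absurd h1 (by simp [d])

/-- **FACT-LIST F-0351, universal closure REFUTED modulo F-0369** (fully quantified form, universe `0`):
granted the FACT-LIST row F-0369 `Rmk_1_5_4_i` ("every sub-`p`-adic field is Kummer-faithful",
Rmk. 1.5.4 (i) p. 33), it is NOT the case that Prop. 1.6 (ii) as typed holds for every interface model `M`
— `ℚ_2` is sub-`2`-adic (it embeds into itself, a finitely generated extension of `ℚ_2`), hence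
Kummer-faithful, and `exists_not_prop_1_6_ii_of_isKummerFaithful` applies.  So the closed schema of F-0351
is inconsistent with F-0369; the admissible reading of F-0351 is the instance at the intended étale-`π₁`
model (not constructed in the tree). [cite: MochizukiAbsTopIII2015, Prop 1.6 (ii) p.35] -/
theorem not_forall_prop_1_6_ii_of_rmk_1_5_4_i
    (h : Literature.AnabelianGeometry.AbsoluteAnabelian.AbsTopIII.Rmk_1_5_4_i.{0}) :
    ¬ ∀ M : DivisorCurveModel.{0},
      Literature.AnabelianGeometry.AbsoluteAnabelian.AbsTopIII.DivisorCurveModel.Prop_1_6_ii M := by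
  have hfg : (⊤ : IntermediateField ℚ_[2] ℚ_[2]).FG := IntermediateField.fg_of_noetherian ⊤
  have hsub : IsSubpadic ℚ_[2] :=
    IsSubpadic.mk ⟨2, inferInstance,
      IsSubpadicFor.mk ⟨ℚ_[2], inferInstance, inferInstance, hfg, ⟨RingHom.id _⟩⟩⟩
  obtain ⟨M, hM⟩ := exists_not_prop_1_6_ii_of_isKummerFaithful ℚ_[2] (h ℚ_[2] hsub)
  exact fun H => hM (H M)

end Literature.AnabelianGeometry.AbsoluteAnabelian.AbsTopIII.DivisorCurveModel

end
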